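import Mathlib
import HarnessLib
import HarnessLib.Audit
import Summits.RiemannHypothesis.Statement
import Literature.NumberTheory.LFunctions.RiemannXi

/-!
Route: NodalHairpin

CLOSED (exhausted) 2026-08-16T05:16:34Z by planner-rbadge-RiemannHypothesis-NodalHairpin-8ef4f0b7-g3-0 — reason: exhausted — note: route-repair g3 (rbadge; tenure decision on `route.crux-floor`). CENSUS (full text: evidence CENSUS.md on stmt-8587/8586): the deciding theorem is `closes : NodalNoHairpinRegular → NodalDictionaryRegular → RH` (native OK). By the crux test only X* = NodalNoHairpinRegular is a genuine research obstru. The file is kept as the record of this route; refuted decls are indexed as negative knowledge (`ledger negatives`).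

# Route NodalHairpin — off-line zeros are hairpins: the critical line is a nodal line of Re ∫ξ, the
zeros are its saddles, and RH says every regular nodal line lands

**Thesis X\* (words).** Let F(s) := ∫_{1/2}^{s} ξ(w) dw (ξ =
`Literature.NumberTheory.LFunctions.riemannXi`; the segment primitive,
inlined as (∫₀¹ ξ(1/2 + u(s − 1/2)) du)·(s − 1/2)). F(1 − s̄) = −conj F(s), so H := Re F vanishes on
the critical line and
∇H = (Re ξ, −Im ξ): the critical points of the harmonic function H are exactly the zeros of ξ, all
saddles. X\* (item
`NodalNoHairpinRegular`, the repaired target over the REGULAR nodal set U′ := {s : Re s > 1/2, H(s)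
= 0, ξ(s) ≠ 0}): every
connected component of U′ contains, for every ε > 0, a point of real part < 1/2 + ε — no regular
nodal line that enters from σ = +∞
turns back (no HAIRPIN) or runs away vertically at positive distance from the line. Card realised:
nodal-hairpin-foliation. Rev-1 X
(closure form over the full nodal set {H = 0}) was weaker than RH — a TRIDENT, an off-line zero ON
the nodal set feeding three
rungs, satisfies it — and is dropped at rev 5 together with its dictionary and assembly.
Lean: `∀ s : ℂ, s ∈ {w : ℂ | 1 / 2 < w.re ∧ ((∫ u in (0:ℝ)..1,
Literature.NumberTheory.LFunctions.riemannXi (1 / 2 + (u : ℂ) * (w - 1 / 2))) * (w - 1 / 2)).re = 0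
∧ Literature.NumberTheory.LFunctions.riemannXi w ≠ 0} → ∀ ε : ℝ, 0 < ε → ∃ w ∈ connectedComponentIn
{w : ℂ | 1 / 2 < w.re ∧ ((∫ u in (0:ℝ)..1, Literature.NumberTheory.LFunctions.riemannXi (1 / 2 + (u
: ℂ) * (w - 1 / 2))) * (w - 1 / 2)).re = 0 ∧ Literature.NumberTheory.LFunctions.riemannXi w ≠ 0} s,
w.re < 1 / 2 + ε`

## Assembly
Deciding theorem (glue.lean, proved sorry-free in the route file, lean check rc 0, axioms
propext/Classical.choice/Quot.sound):
`closes : NodalNoHairpinRegular → NodalDictionaryRegular → Summit.RiemannHypothesis`. An off-line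
zero ρ with Re ρ > 1/2 gives, by the
dictionary, a component of U′ at distance ≥ ε > 0 from the line, while X\* puts a point of that
component at real part < 1/2 + ε —
contradiction; Re ρ < 1/2 reflects to 1 − ρ by `riemannXi_one_sub`; a nontrivial zero of ζ is a zero
of ξ = ½ s(s−1)Λ
(`riemannXi_eq_mul_completedRiemannZeta`; ζ = Λ/Γ_ℝ, Γ_ℝ(s) = 0 only at s = −2n), hence on Re s =
1/2: Mathlib's `RiemannHypothesis` =
`Summit.RiemannHypothesis`. NodalProper and NodalConverse are not hypotheses of `closes`: they make
X\* FAITHFUL (not stronger than RH)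
and are the route's unconditional theorem targets. The `Assembly` item is restated at rev 5 to the
deciding theorem's shape (rev-1
`Assembly` X_old → RH was unprovable because X_old is weaker than RH; the support
NodalClosesRegular, whose content is exactly `closes`,
is dropped as redundant, as are the rev-1 target NodalNoHairpin and dictionary NodalDictionary).

Rationale: WHY THIS LINE. One integration turns the zeros of ξ into the SADDLES of one explicit harmonic
function H whose nodal set contains the critical
line, so "ξ has an off-line zero" becomes a statement about the END STRUCTURE of the nodal tracts of
H: on a tract with e channels
to σ = +∞ a positive harmonic function vanishing on the finite boundary is Σ_{i≤e} cᵢhᵢ over the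
minimal Martin functions of the
ends and carries e − 1 interior critical points, so an off-line zero needs a two-ended tract, i.e. a
regular nodal line that
comes in from +∞ and returns (hairpin), and conversely. Imported areas: index calculus for critical
points of planar harmonic
functions (Alessandrini–Magnanini zbl:0793.35021, Walsh zbl:0041.04101, Marden doi:10.2307/1993807),
Martin boundary of narrowing
channels (Kjellberg doi:10.1007/bf02591371, Benedicks doi:10.1007/bf02384681), extremal length /
harmonic measure in corridors
(Tsuji zbl:0322.30001, Ahlfors1973CI), the geometric function theory of ξ^(−1) (LagariasMontague2011
= arXiv:1106.4348) and the
Jordan curve theorem (in tree). RH becomes the global topology of one real-analytic foliation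
(product ladder vs. folds),
attackable by continuity/degree arguments in families, planar order (rungs and landings interlace
monotonically, hairpins nest)
and conformal invariants of tracts — handles absent from the pointwise positivity ladders; its local
shadow is the
Lagarias / Sondow–Dumitrescu / Matiyasevich–Saidak–Zvengrowski criterion RH ⇔ Re ξ′/ξ > 0 on σ > 1/2
(LagariasXiPositivity1999,
arXiv:2509.18963), which forbids exactly the left-turning folds. Arithmetic enters only through the
Euler-product ladder
(NodalLadderEuler), the one item the Davenport–Heilbronn function fails.

RANKED CRUXES. #0 NodalNoHairpinRegular (target) — X\* as in § Thesis: every connected component of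
the regular nodal set U′ = {Re s > 1/2, H = 0, ξ ≠ 0} contains points of real part < 1/2 + ε for
every ε > 0. (why it might fail: RH-strength by NodalDictionaryRegular; STRONGER than RH unless
NodalProper holds (a regular nodal end escaping to i∞ at σ ≥ 0.6 violates X\* with no zero around) —
see NodalConverse.) [card:RiemannHypothesis/RiemannHypothesis/nodal-hairpin-foliation,
arXiv:1106.4348, zbl:0793.35021, doi:10.1088/1402-4896/aabca9,
Literature.Barriers.RiemannHypothesis.DavenportHeilbronn]
#2 NodalDictionaryRegular (crux) — THE DICTIONARY over the regular nodal set (unconditional theorem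
target): if ξ(ρ) = 0 with Re ρ > 1/2 then some connected component of U′ stays at distance ≥ ε > 0
from the critical line. Mechanism (generic case H(ρ) = c ≠ 0): the two components of {H > c} at the
saddle are distinct (minimum principle), unbounded, of bounded height in every strip (NodalDecay),
hence drain into the far field, where {H > c} meets each positive channel between consecutive rungs
in ONE band (∂_t H = −Im ξ changes sign once per channel since Re ξ′/ξ > 0 on σ > 1); the Jordan
loop through ∞ formed by the two lobes confines every rung between the two channels to a cusp off
the line; the H(ρ) = 0 (trident) case uses the opposite {H > 0} sectors at ρ with a small level.
[deps: NodalDecay, NodalLadderFar] [difficulty: L] (why it might fail: Saddle's two superlevel lobes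
must exit via DISTINCT far channels: needs one {H>c}-band per channel (sections unimodal from Re
ξ′/ξ>0) down to the abscissa where the lobes arrive, maybe <1 at low height; far-ladder uniformity
near t≈0; FE-generic, so a DH-type model could break the SHAPE.) [zbl:0793.35021,
doi:10.1007/bf02591371, arXiv:1106.4348, LagariasXiPositivity1999,
Literature.Topology.PlaneTopology.JordanCurveTheorem_holds, Titchmarsh1986 §10.25, Spira1994,
doi:10.1090/s0025-5718-07-01999-0, Literature.Barriers.RiemannHypothesis.DavenportHeilbronn]
#3 NodalProper (crux) — PROPERNESS / NO VERTICAL ESCAPE: every connected subset of the nodal set {Re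
s > 1/2, H = 0} lying in a vertical strip Re s ≤ σ₁ is bounded — no nodal end runs to ±i∞ inside a
strip (neither between rungs, nor asymptotically to the line, nor through an infinite chain of nodal
saddles). Needed by NodalConverse and by every counting statement, NOT by NodalDictionaryRegular;
potential theory alone cannot give it (decaying harmonic counter-model e^(−πt/w) sin(π(σ−σ_a)/w) in
a half-strip), the proof must use the vertical oscillation of ξ (≪ log T rungs per unit height,
corridor widths ~ 2π/log T: harmonic measure / extremal length between consecutive landing arcs).
[deps: NodalLadderFar, NodalLadderEuler, NodalDecay] [difficulty: L] (why it might fail: H→0 at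
vertical infinity in every strip, so size alone cannot control U there; Jensen bounds the escaping
ends launched below T only by O(log T), not 0; an end may creep up between rungs or cross every
landing arc through nodal saddles (off-line zeros ON nodal arcs, infinitely often); FE-generic.)
[Ahlfors1973CI, zbl:0322.30001, doi:10.1007/bf02591371, arXiv:1106.4348, Titchmarsh1986 §9.3–9.4,
Literature.NumberTheory.LFunctions.Landau1911_zetaArgS_not_bddBelow]
#4 NodalConverse (crux) — CONVERSE DICTIONARY (faithfulness of X\*; unconditional theorem target
with properness as hypothesis): if NodalProper holds and some component of U′ stays at distance ≥ ε
> 0 from the critical line, then ξ has a zero ρ with Re ρ > 1/2. With no off-line zero U′ = U is a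
proper 1-manifold whose ends are rungs or landings; a line-avoiding component is a hairpin joining
two rungs, rungs between them pair into nested hairpins, the innermost joins consecutive rungs; the
tract of {H ≠ 0} just outside it is simply connected with two far channels, each ONE minimal Martin
point (narrowing channels of width ≍ π/L(σ); Kjellberg, Benedicks), so |H| = c₁h₁ + c₂h₂ carries an
interior critical point (strip model / argument principle), i.e. a zero of ξ off the line —
contradiction. [deps: NodalProper, NodalLadderFar, NodalDecay] [difficulty: L] (why it might fail:
Needs each far channel to be ONE minimal Martin point and an (e−1)-type saddle count on tracts with
possibly infinitely many channels (nested hairpin cascades): accumulating atoms have no proven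
count, and a non-atomic end mass may carry no saddle (harmonic measure of an arc has none).)
[doi:10.1007/bf02591371, doi:10.1007/bf02384681, zbl:0793.35021, zbl:0041.04101,
doi:10.2307/1993807, Ahlfors1973CI, arXiv:1106.4348]
#9 NodalLadderFar (support) — FAR-FIELD LADDER: there is σ₁ such that on U ∩ {Re s ≥ σ₁} one has Im
ξ(s) ≠ 0 — the nodal set is transverse to verticals there, hence a ladder of graphs over σ, one rung
per Gram-type level of arg ξ(σ₁ + it). Endpoint-dominated tail integral H = Im ∫_t^∞ ξ(σ+iτ)dτ ≈
Re(ξ·conj L)/|L|² with L = ξ′/ξ = ½ log(s/2π) + O(1/|s|); uniform Stirling; two regimes (refuter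
briefing on the item). Routine. [difficulty: M] [arXiv:1106.4348 Lemma 3.3,
LagariasXiPositivity1999, Titchmarsh1986 §2.12, §4.42]
#9 NodalLadderEuler (support) — EULER-PRODUCT LADDER (where arithmetic enters): for every δ > 0
there is T₀ such that on {Re s ≥ 1 + δ, |Im s| ≥ T₀} ∩ {H = 0} one has Im ξ(s) ≠ 0 (integration by
parts with L = ξ′/ξ, |L′| ≪ δ⁻² from bounded (ζ′/ζ)′ on σ ≥ 1 + δ). Confines every hairpin nose at
height ≥ T₀ to Re s ≤ 1 + δ; FALSE for the Davenport–Heilbronn function (zeros in σ > 1).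
[difficulty: M] [Titchmarsh1986 §2.12, §3.1, §10.25, LagariasXiPositivity1999, arXiv:1106.4348,
Literature.Barriers.RiemannHypothesis.DavenportHeilbronn, doi:10.1070/rm2011v066n02abeh004740]
#9 NodalDecay (support) — H → 0 at vertical infinity, uniformly in vertical strips 1/2 ≤ Re s ≤ σ₁
(|H| ≤ ∫_t^∞ |ξ(σ+iτ)| dτ and ξ decays like e^(−π|τ|/4)|τ|^C in the strip; path independence of the
primitive). Known: Lagarias–Montague Lemma 3.3 ∘ (Re F = 0 on the line + horizontal FTC).
[difficulty: provable-now] [Titchmarsh1986 §2.12, arXiv:1106.4348 Thm 2.1,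
Literature.NumberTheory.LFunctions.differentiable_riemannXi]
#9 NodalPrimitive (support) — the inlined segment integral w ↦ (∫₀¹ ξ(1/2 + u(w − 1/2)) du)(w − 1/2)
is a primitive of ξ (HasDerivAt … (ξ s) s); candidate proofs attached to the item (rc 0).
[difficulty: provable-now] [Literature.NumberTheory.LFunctions.differentiable_riemannXi, Mathlib
intervalIntegral.hasDerivAt / Complex primitives]
#9 NodalOddSymmetry (support) — F(1 − conj s) = −conj F(s), from ξ(1 − s) = ξ(s) and Schwarz
reflection; hence H is odd under reflection in the critical line and vanishes on it; candidate proof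
attached to the item (rc 0). [difficulty: provable-now]
[Literature.NumberTheory.LFunctions.riemannXi_one_sub,
Literature.NumberTheory.LFunctions.riemannXi_conj_holds]

TWO-LAYER PLAN. Foreseen glued splits, nothing filed until a crux closes: NodalConverse ⇐
ConverseMartin (each far channel of a two-ended tract is one
minimal Martin point) → ConverseCount (c₁h₁ + c₂h₂ on a simply connected two-ended tract has an
interior critical point) → NodalConverse;
NodalProper ⇐ ProperFar (σ ≥ σ₁, from the ladder) → ProperStrip (corridor extremal length between
consecutive landing arcs) → NodalProper;
NodalDictionaryRegular ⇐ DictGeneric (H(ρ) ≠ 0) → DictNodal (H(ρ) = 0, trident sectors) →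
NodalDictionaryRegular.

KILL CRITERIA. (i) NodalDictionaryRegular refuted substantively — an off-line-zero configuration
(for ξ or for an FE-symmetric entire function of the
same growth and far-field shape) whose saddle is absorbed with NO line-avoiding regular component —
closes the route
`refuted:NodalDictionaryRegular` unless a tract-end-count restatement survives (the trident killed
only the rev-1 closure form).
(ii) NodalProper refuted by an escaping regular nodal end with no zero nearby ⇒ X\* is false
independently of RH ⇒ one repair (restate
the target over bounded-height components) or close. (iii) A certified hairpin of H below the
RH-verified height 3·10¹² refutes
NodalConverse ∘ NodalProper (faithfulness) ⇒ close as a dictionary without teeth. (iv) After #2–#4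
land, if refuters show every
handle on X\* reduces to pointwise Re ξ′/ξ > 0 on σ > 1/2 (Lagarias/MSZ) with no global or
topological residue ⇒ close as pure
reformulation. A proof of RH elsewhere moots the route; a proof of NodalDictionaryRegular +
NodalConverse + NodalProper alone is
already a publishable two-way dictionary.

NOT DECOMPOSED YET. No quantitative dictionary item (N(T) − N₀(T) = 2·#hairpins below T + O(log T));
no separate Martin-boundary or critical-point-count
items under NodalConverse and no corridor extremal-length item under NodalProper (they are the
foreseen layer-2 children above); no
Davenport–Heilbronn control item (the barrier file is cited instead); no certified level-line
tracking item (companion card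
nodal-hairpin-certified-tracking, retired); no `xiPrimitive` definition request — statements inline
the segment integral, and the
grounders' pending Literature files (p45481 XiPrimitive / p45600 XiIntegral, rfl-compatible with the
inlined term; p45512
LagariasXiPositivity) will be cited by provers, not re-filed here.

CHEAPEST FALSIFIER. A kit portrait of the nodal set of H = Re ∫_(1/2)^s ξ on [1/2, 6] × [0, 200]
(mpmath ξ at 30 digits, interval-validated sign changes
on a grid, rungs tracked inward from σ = 6): every rung must land at a critical zero 1/2 + iγ_n in
order, none may turn back or
creep vertically, and Im ξ ≠ 0 along rungs for σ ≥ 2. One returning or escaping regular nodal line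
at these RH-verified heights
kills NodalConverse ∧ NodalProper (faithfulness of X\*) at once; a rung point with Im ξ = 0 at σ ≥ 2
kills NodalLadderFar with
σ₁ = 2. Not run from this repair seat (no kit job filed); refuters run it first.

NUMBERS. A₀ = ∫₀^∞ Ξ = π·Φ(0) ≈ 2.80668 (F(1/2 + it) → iA₀, LagariasMontague2011 Thm 2.1); |σ| =
(π/2)|t|/log|t| + O(|t|/log²|t|) on level
curves of ξ^(−1), |t| ≥ 4πe (Thm 2.2); RH verified to height 3·10¹²
(doi:10.1090/s0025-5718-07-01999-0 and successors); rungs per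
unit height ≍ (1/2π) log(T/2π). Items after rev 5: 10 (1 target, 3 cruxes, 5 supports, 1 assembly
restated to the shape of `closes`).

DEFINITION REQUESTS. None filed: `xiPrimitive`/`xiIntegral` (the inlined segment primitive) is
proposed by grounders as Literature (p45481 / p45600);
items keep the inlined term so no signature changes are needed when it lands (rfl).

Novelty: Searches (2026-08-15; lit services intermittently rc 75): zbMATH "Tsuji potential theory" (→
zbl:0322.30001), "Kjellberg positive harmonic functions" (→ doi:10.1007/bf02591371), "Alessandrini
Magnanini index critical points" (→ zbl:0793.35021), "Walsh critical points" (→ zbl:0041.04101;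
Marden doi:10.2307/1993807), "Benedicks positive harmonic functions vanishing on boundary" (→
doi:10.1007/bf02384681), "Davenport Heilbronn zeros of certain Dirichlet series" (→
DavenportHeilbronn1936a; doi:10.1070/rm2011v066n02abeh004740); lean search: Jordan curve thm PROVED
in tree; rev-1 searches (lit frontier → arXiv:2509.18963; galaxy 0 hits) + two refuter card audits
(new-combination).
Nearest prior art: Lagarias–Montague arXiv:1106.4348 (same object ξ^(−1); its zeros only); Schleich
et al. doi:10.1088/1402-4896/aabca9 and Neuberger et al. doi:10.1088/1367-2630/16/10/103023 (RH_f ⇔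
constant-phase lines merge with the critical line: the same SHAPE one derivative up, saddles = zeros
of ξ′); LevinsonMontgomery1974 (ξ′-pairing).
Delta: integrating once makes the zeros of ξ themselves the saddles of H = Re ξ^(−1), so off-line
zeros are an exact end-count of nodal tracts (index calculus; no simplicity or ξ′-transfer
hypothesis), and the repaired dictionary over the REGULAR nodal set is a two-way provable
equivalence with a Davenport–Heilbronn control and an Euler-product watermark (NodalLadderEuler) — a
combination absent from the searched literature.
Claimed grade: new-combination  [refs: 10.1007/bf02591371, 10.2307/1993807, 10.1007/bf02384681, 10.1070/rm2011v066n02abeh004740, 10.1088/1402-4896/aabca9, 10.1088/1367-2630/16/10/103023, 2509.18963, 1106.4348, doi:10.1007/bf02591371, doi:10.2307/1993807, doi:10.1007/bf02384681, doi:10.1070/rm2011v066n02abeh004740, doi:10.1088/1402-4896/aabca9, doi:10.1088/1367-2630/16/10/103023, DavenportHeilbronn1936a, LevinsonMontgomery1974]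

Barriers (technique_class: nodal-foliation harmonic-primitive index-calculus): - technique_class: nodal-foliation harmonic-primitive index-calculus
- Literature.Barriers.RiemannHypothesis.DavenportHeilbronn: NOT evaded by the dictionary and used as
CONTROL — NodalDictionaryRegular, NodalProper, NodalConverse, NodalLadderFar, NodalDecay use only
functional equation, reflection and growth, so hold verbatim for the DH function, whose off-line
zeros give genuine hairpins; no proof of X can come from them. Arithmetic enters through
NodalLadderEuler (bounded ζ′/ζ, (ζ′/ζ)′ on σ ≥ 1+δ — what DH lacks, having zeros in σ > 1),
confining noses to the critical strip; the bet: topological/deformation arguments transport this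
ladder inward; kill criterion (iv) retires the route otherwise.
- Literature.Barriers.RiemannHypothesis.GramRosserFailures: the far ladder is indexed by Gram-type
levels of arg ξ(σ₁+it) but no item asserts WHICH zero a rung reaches (monotone matching shifted by
S(T)); Gram/Rosser failures are rung–zero offsets, not hairpins. Not hit.
- Literature.Barriers.RiemannHypothesis.LindelofBacklund: not engaged — no size bound is converted
into emptiness; N(T), S(T) = O(log T) enter only as bookkeeping.
- Literature.Barriers.RiemannHypothesis.NewmanConjecture: a future deformation item through the heat
flow must respect Λ ≥ 0 (ξ sits at the threshold); none is filed at this revision, the dictionary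
items are flow-free.
- Negatives index: empty for RiemannHypothesis at this revision (ledger negatives, 2026-08-15).

History (route lifecycle, newest last):
- 2026-08-15T16:17:26Z · rev 5: restated Assembly (stmt-RiemannHypothesis-1023) — route-repair (rbadge g2): deciding theorem `closes : NodalNoHairpinRegular → NodalDictionaryRegular → Summit.RiemannHypothesis` PROVED in-file (glue.lean; nativ (planner-rbadge-RiemannHypothesis-NodalHairpin-8ef4f0b7-g2-0)
- 2026-08-15T16:17:26Z · rev 5: dropped NodalNoHairpin, NodalDictionary, NodalClosesRegular — route-repair (rbadge g2): deciding theorem `closes : NodalNoHairpinRegular → NodalDictionaryRegular → Summit.RiemannHypothesis` PROVED in-file (glue.lean; nativ (planner-rbadge-RiemannHypothesis-NodalHairpin-8ef4f0b7-g2-0)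
- 2026-08-16T04:16:24Z · AUTO-CRUX (backfill): NodalNoHairpinRegular — hypotheses of the deciding theorem that nothing in the route derives are cruxes (operator:999:1085951)
- 2026-08-16T05:16:34Z · CLOSED exhausted — exhausted (planner-rbadge-RiemannHypothesis-NodalHairpin-8ef4f0b7-g3-0)

sub-problem: RiemannHypothesis · status: closed(exhausted) · opened planner-plancards-RiemannHypothesis-RiemannHypothesis-20260815w1-2-0 2026-08-15T10:39:31Z · rev 6 · ledger route-RiemannHypothesis-NodalHairpin
GENERATED by the gate from the ledger (D-0016/17). Provers cite these decls: `theorem foo : Summit.RiemannHypothesis.RiemannHypothesis.Theses.NodalHairpin.<Decl> := …` in Summits/RiemannHypothesis/RiemannHypothesis/Theorems/<Name>.lean.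
-/

namespace Summit.RiemannHypothesis.RiemannHypothesis.Theses.NodalHairpin

open scoped BigOperators Topology Manifold Classical MeasureTheory ProbabilityTheory Matrix InnerProductSpace ComplexConjugate ContinuousMap
open Filter Set Function TopologicalSpace MeasureTheory

attribute [summit_statement] _root_.Summit.RiemannHypothesis

open Summit

/-- item stmt-RiemannHypothesis-8587 · crux (kind.auto-crux: conjecture-grade) · rank 0 · closed · moot by None · by planner
why it might fail: RH-strength: by NodalDictionaryRegular any off-line zero yields a regular nodal arc at positive distance from the line (hairpin or trident arm). Conversely it is STRONGER than RH unless NodalProper holds (a rung escaping to i∞ at σ ≥ 0.6 violates X with no zero around) — see NodalConverse.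
sources: card:RiemannHypothesis/RiemannHypothesis/nodal-hairpin-foliation, arXiv:1106.4348, zbl:0793.35021, doi:10.1088/1402-4896/aabca9, Literature.Barriers.RiemannHypothesis.DavenportHeilbronn
[target] (REPAIRED TARGET X over U' — supersedes NodalNoHairpin/stmt-RiemannHypothesis-1018, which
is weaker than RH (trident); tenure planner/opener should restate the target and the Assembly to
`NodalDictionaryRegular → NodalNoHairpinRegular → Summit.RiemannHypothesis`, see support
NodalClosesRegular) X as in § Thesis: every connected component of the regular nodal set U' = {Re s
> 1/2, H = 0, ξ ≠ 0} contains points with real part < 1/2 + ε for every ε > 0. — why it might fail: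
RH-strength: by NodalDictionary any off-line zero yields a regular nodal arc at positive distance
from the line (hairpin or trident arm). Conversely it is STRONGER than RH unless NodalProper holds
(a rung escaping to i∞ at σ ≥ 0.6 violates X with no zero around) — see NodalConverse. — sources:
card:RiemannHypothesis/RiemannHypothesis/nodal-hairpin-foliation, arXiv:1106.4348, zbl:0793.35021,
doi:10.1088/1402-4896/aabca9, Literature.Barriers.RiemannHypothesis.DavenportHeilbronn -/
@[route_item "route-RiemannHypothesis-NodalHairpin"]
def NodalNoHairpinRegular : Prop :=
  ∀ s : ℂ, s ∈ {w : ℂ | 1 / 2 < w.re ∧ ((∫ u in (0:ℝ)..1, Literature.NumberTheory.LFunctions.riemannXi (1 / 2 + (u : ℂ) * (w - 1 / 2))) * (w - 1 / 2)).re = 0 ∧ Literature.NumberTheory.LFunctions.riemannXi w ≠ 0} → ∀ ε : ℝ, 0 < ε → ∃ w ∈ connectedComponentIn {w : ℂ | 1 / 2 < w.re ∧ ((∫ u in (0:ℝ)..1, Literature.NumberTheory.LFunctions.riemannXi (1 / 2 + (u : ℂ) * (w - 1 / 2))) * (w - 1 / 2)).re = 0 ∧ Literature.NumberTheory.LFunctions.riemannXi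 w ≠ 0} s, w.re < 1 / 2 + ε

/-- item stmt-RiemannHypothesis-8586 · crux · rank 2 · closed · moot by None · by planner
why it might fail: Saddle's two superlevel lobes must exit via DISTINCT far channels: needs one {H>c}-band per channel (sections unimodal from Re ξ′/ξ>0) down to the abscissa where the lobes arrive, maybe <1 at low height; far-ladder uniformity near t≈0; FE-generic, so a DH-type model could break the SHAPE.
sources: zbl:0793.35021, doi:10.1007/bf02591371, arXiv:1106.4348, LagariasXiPositivity1999, Literature.Topology.PlaneTopology.JordanCurveTheorem_holds, Titchmarsh1986 §10.25
[crux] (REPAIRED DICTIONARY over the regular nodal set U' — supersedes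
NodalDictionary/stmt-RiemannHypothesis-1019, whose rev-1 form fails on the refuter's TRIDENT; the
tenure planner/opener should `route edit --drop NodalDictionary` or `--restate` it to this text) THE
DICTIONARY (restated over the regular nodal set; unconditional theorem target): if ξ(ρ) = 0 with Re
ρ > 1/2 then some connected component of U' stays at distance ≥ ε > 0 from the critical line.
Generic case H(ρ) = c ≠ 0: the two components of {H > c} (c > 0, say) at the saddle ρ are distinct
(minimum principle inside the loop otherwise), unbounded, confined to bounded height in every strip
(H → 0 at vertical infinity, support NodalDecay), hence drain into the far field, where {H > c}
meets each positive channel between consecutive rungs in ONE connected band (∂_t H = −Im ξ has one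
sign change per channel because ∂_t arg ξ = Re ξ′/ξ > 0 on σ > 1); so they use two distinct channels
A below B, and any rung R between A and B belongs to a nodal component K all of whose ends are rungs
between A and B (a landing end or a vertical end would, with the line, separate A from B:
theta-graph / Jordan on the compactified half-plan -/
@[route_item "route-RiemannHypothesis-NodalHairpin"]
def NodalDictionaryRegular : Prop :=
  ∀ ρ : ℂ, Literature.NumberTheory.LFunctions.riemannXi ρ = 0 → 1 / 2 < ρ.re → ∃ s : ℂ, s ∈ {w : ℂ | 1 / 2 < w.re ∧ ((∫ u in (0:ℝ)..1, Literature.NumberTheory.LFunctions.riemannXi (1 / 2 + (u : ℂ) * (w - 1 / 2))) * (w - 1 / 2)).re = 0 ∧ Literature.NumberTheory.LFunctions.riemannXi w ≠ 0} ∧ ∃ ε : ℝ, 0 < ε ∧ ∀ w ∈ connectedComponentIn {w : ℂ | 1 / 2 < w.re ∧ ((∫ u in (0:ℝ)..1, Literature.NumberTheory.LFunctions.riemannXi (1 / 2 + (u : ℂ) * (w - 1 / 2))) * (w - 1 / 2)).re = 0 ∧ Literature.NumberTheory.LFunctions.riemannXi w ≠ 0} s, 1 / 2 + ε ≤ w.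re

/-- item stmt-RiemannHypothesis-8547 · crux · rank 3 · closed · moot by None · by planner
why it might fail: H→0 at vertical infinity in every strip, so size alone cannot control U there; Jensen bounds the escaping ends launched below T only by O(log T), not 0; an end may creep up between rungs or cross every landing arc through nodal saddles (off-line zeros ON nodal arcs, infinitely often); FE-generic.
sources: Ahlfors1973CI, zbl:0322.30001, doi:10.1007/bf02591371, arXiv:1106.4348, Titchmarsh1986 §9.3–9.4, Literature.NumberTheory.LFunctions.Landau1911_zetaArgS_not_bddBelow
[crux] PROPERNESS / NO VERTICAL ESCAPE: every connected subset of the nodal set {Re s > 1/2, H = 0}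
that lies in a vertical strip Re s ≤ σ₁ is bounded. Equivalently no nodal end runs to ±i∞ inside a
strip (neither between rungs, nor asymptotically to the line, nor through an infinite chain of nodal
saddles). It is the compactness that turns the foliation into a combinatorial object (rungs from +∞,
landings at critical zeros, finitely many saddles per window) and that the converse direction and
every counting statement (N(T) − N₀(T) = 2·#hairpins + O(log T)) need; in the far field it follows
from the ladder (supports), in the critical strip it is a Carleman–Tsuji / harmonic-measure
statement about this particular H, of the flavour of the Denjoy–Carleman–Ahlfors tract count but in
the decaying regime. [deps: NodalLadderFar, NodalLadderEuler, NodalDecay] [difficulty: L] — why it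
might fail: H→0 at vertical infinity in every strip, so size alone cannot control U there; Jensen
bounds the escaping ends launched below T only by O(log T), not 0; an end may creep up between rungs
or cross every landing arc through nodal saddles (off-line zeros ON nodal arcs, infinitely often);
FE-generic. — -/
@[route_item "route-RiemannHypothesis-NodalHairpin"]
def NodalProper : Prop :=
  ∀ σ₁ : ℝ, ∀ S : Set ℂ, S ⊆ {w : ℂ | 1 / 2 < w.re ∧ w.re ≤ σ₁ ∧ ((∫ u in (0:ℝ)..1, Literature.NumberTheory.LFunctions.riemannXi (1 / 2 + (u : ℂ) * (w - 1 / 2))) * (w - 1 / 2)).re = 0} → IsConnected S → Bornology.IsBounded S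

/-- item stmt-RiemannHypothesis-8588 · crux · rank 4 · closed · moot by None · by planner
why it might fail: Needs each far channel to be ONE minimal Martin point and an (e−1)-type saddle count on tracts with possibly infinitely many channels (nested hairpin cascades): accumulating atoms have no proven count, and a non-atomic end mass may carry no saddle (harmonic measure of an arc has none).
sources: doi:10.1007/bf02591371, doi:10.1007/bf02384681, zbl:0793.35021, zbl:0041.04101, doi:10.2307/1993807, Ahlfors1973CI
[crux] CONVERSE DICTIONARY (faithfulness of X; unconditional theorem target with properness as
hypothesis): if NodalProper holds and some component of U' stays at distance ≥ ε > 0 from the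
critical line, then ξ has a zero ρ with Re ρ > 1/2. Mechanism: with no off-line zero U' = U is a
proper 1-manifold whose ends are rungs or landings (properness + far ladder); a line-avoiding
component is a hairpin joining rungs R_j, R_m; the tract of {H ≠ 0} just outside it contains two
distinct far channels, each a single minimal Martin point (narrowing channels of width ≍ 2π/log σ;
Kjellberg, Benedicks), so |H| = Σ cᵢhᵢ with ≥ 2 atoms and carries ≥ 1 interior critical point
(Walsh–Marden count / mountain pass), i.e. a zero of ξ — contradiction. Together with
NodalDictionary this makes X ⇔ RH (given NodalProper) a pair of tree theorems; it also yields the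
¬RH certificate "a level line that returns" of the retired companion card
nodal-hairpin-certified-tracking. [deps: NodalProper, NodalLadderFar, NodalDecay] [difficulty: L] —
why it might fail: Needs each far channel to be ONE minimal Martin point and an (e−1)-type saddle
count on tracts with possibly infinitely many channels (nested hairpin cas -/
@[route_item "route-RiemannHypothesis-NodalHairpin"]
def NodalConverse : Prop :=
  (∀ σ₁ : ℝ, ∀ S : Set ℂ, S ⊆ {w : ℂ | 1 / 2 < w.re ∧ w.re ≤ σ₁ ∧ ((∫ u in (0:ℝ)..1, Literature.NumberTheory.LFunctions.riemannXi (1 / 2 + (u : ℂ) * (w - 1 / 2))) * (w - 1 / 2)).re = 0} → IsConnected S → Bornology.IsBounded S) → (∃ s : ℂ, s ∈ {w : ℂ | 1 / 2 < w.re ∧ ((∫ u in (0:ℝ)..1, Literature.NumberTheory.LFunctions.riemannXi (1 / 2 + (u : ℂ) * (w - 1 / 2))) * (w - 1 / 2)).re = 0 ∧ Literature.NumberTheory.LFunctions.riemannXi w ≠ 0} ∧ ∃ ε : ℝ, 0 < ε ∧ ∀ w ∈ connectedComponentIn {w : ℂ | 1 / 2 < w.re ∧ ((∫ u in (0:ℝ)..1,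 Literature.NumberTheory.LFunctions.riemannXi (1 / 2 + (u : ℂ) * (w - 1 / 2))) * (w - 1 / 2)).re = 0 ∧ Literature.NumberTheory.LFunctions.riemannXi w ≠ 0} s, 1 / 2 + ε ≤ w.re) → ∃ ρ : ℂ, Literature.NumberTheory.LFunctions.riemannXi ρ = 0 ∧ 1 / 2 < ρ.re

/-- item stmt-RiemannHypothesis-1020 · support · rank 3 · closed · moot by None · by planner
why it might fail: Uniformity in t of the endpoint asymptotics near small |t| (L nearly real, slow oscillation) or an error comparable to |Im L|/|L| ~ π/(2 log|s|) could leave nodal points with Im ξ = 0 at moderate σ; then σ₁ must grow or the statement needs t ≥ t₀.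
sources: arXiv:1106.4348 Lemma 3.3, LagariasXiPositivity1999, Titchmarsh1986 §2.12, §4.42
FAR-FIELD LADDER (crux #3): there is σ₁ such that on U ∩ {Re s ≥ σ₁} one has Im ξ(s) ≠ 0 — the nodal
set is transverse to vertical lines there, hence locally a graph over σ, and (with properness) a
ladder of disjoint nearly horizontal curves C_k, one per Gram-type level of arg ξ(σ₁+it). Mechanism:
F(σ+it) = i c₀ − i∫_t^∞ ξ(σ+iτ)dτ with c₀ = ∫₀^∞ Ξ real, so H = Im ∫_t^∞ ξ(σ+iτ)dτ; the integral is
endpoint-dominated (phase derivative Re ξ′/ξ > 0, no stationary point; amplitude slowly varying),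
giving H = Re(ξ(s)·conj L/|L|²)(1 + O(1/log σ)) with L = ξ′/ξ(s) = ½log(s/2π) + O(1/|s|), Im L/Re L
= O(1/log|s|); on {H = 0}, Im ξ = 0 would force Re ξ = 0, i.e. ξ(s) = 0, impossible for σ > 1.
Inputs: Stirling for Γ′/Γ and ψ uniform in t, ζ′/ζ(s) = O(2^{−σ}) — all classical; provable now.
Vacuous at t = 0 (H(σ) = ∫_{1/2}^σ ξ > 0). -/
@[route_item "route-RiemannHypothesis-NodalHairpin"]
def NodalLadderFar : Prop :=
  ∃ σ₁ : ℝ, ∀ s : ℂ, σ₁ ≤ s.re → ((∫ u in (0:ℝ)..1, Literature.NumberTheory.LFunctions.riemannXi (1 / 2 + (u : ℂ) * (s - 1 / 2))) * (s - 1 / 2)).re = 0 → (Literature.NumberTheory.LFunctions.riemannXi s).im ≠ 0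

/-- item stmt-RiemannHypothesis-1021 · support · rank 9 · closed · moot by None · by planner
sources: Literature.NumberTheory.LFunctions.differentiable_riemannXi, Mathlib intervalIntegral.hasDerivAt / Complex primitives
SUPPORT (provable now): the inlined segment integral w ↦ (∫₀¹ ξ(1/2 + u(w−1/2)) du)(w − 1/2) is a
primitive of ξ: HasDerivAt … (riemannXi s) s. Standard for an entire function
(differentiable_riemannXi; differentiate under the integral / Mathlib's path-integral primitive
API). Gives ∇H = (Re ξ, −Im ξ): critical points of H = zeros of ξ. -/
@[route_item "route-RiemannHypothesis-NodalHairpin"]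
def NodalPrimitive : Prop :=
  ∀ s : ℂ, HasDerivAt (fun w : ℂ => (∫ u in (0:ℝ)..1, Literature.NumberTheory.LFunctions.riemannXi (1 / 2 + (u : ℂ) * (w - 1 / 2))) * (w - 1 / 2)) (Literature.NumberTheory.LFunctions.riemannXi s) s

/-- item stmt-RiemannHypothesis-1022 · support · rank 9 · closed · moot by None · by planner
sources: Literature.NumberTheory.LFunctions.riemannXi_one_sub, Literature.NumberTheory.LFunctions.riemannXi_conj_holds
SUPPORT (provable now): F(1 − conj s) = −conj F(s), from ξ(1−s) = ξ(s) (riemannXi_one_sub) and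
Schwarz reflection ξ(conj s) = conj ξ(s) (riemannXi_conj_holds), by the substitution w ↦ 1 − conj w
in the segment integral. Hence H = Re F is odd under reflection in the critical line and vanishes on
it: the critical line is a nodal line (F1 of the card). -/
@[route_item "route-RiemannHypothesis-NodalHairpin"]
def NodalOddSymmetry : Prop :=
  ∀ s : ℂ, (∫ u in (0:ℝ)..1, Literature.NumberTheory.LFunctions.riemannXi (1 / 2 + (u : ℂ) * ((1 - conj s) - 1 / 2))) * ((1 - conj s) - 1 / 2) = -conj ((∫ u in (0:ℝ)..1, Literature.NumberTheory.LFunctions.riemannXi (1 / 2 + (u : ℂ) * (s - 1 / 2))) * (s - 1 / 2))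

/-- item stmt-RiemannHypothesis-8589 · support · rank 9 · closed · moot by None · by planner
sources: Titchmarsh1986 §2.12, §3.1, §10.25, LagariasXiPositivity1999, arXiv:1106.4348, Literature.Barriers.RiemannHypothesis.DavenportHeilbronn
[support] EULER-PRODUCT LADDER (new; where arithmetic enters): for every δ > 0 there is T₀ such that
on {Re s ≥ 1 + δ, |Im s| ≥ T₀} ∩ {H = 0} one has Im ξ(s) ≠ 0. One integration by parts, ∫_t^∞
ξ(σ+iτ)dτ = iξ(s)/L(s) + O(∫|ξ||L′/L²|), with |L′| ≤ |(ζ′/ζ)′| + O(1) ≪ δ⁻², Re L = ½log(t/2π) +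
O(δ⁻¹) on σ ≥ 1 + δ, gives H = Re(ξ/L)(1 + O(δ⁻²/log t)), whence on H = 0: arg ξ = arg L ± π/2 +
o(1) and Im ξ ≠ 0. Confines every hairpin nose at height ≥ T₀ to Re s ≤ 1 + δ. FALSE for the
Davenport–Heilbronn analogue (zeros, hence nodal saddles and noses, in σ > 1): this is the first
item a DH function cannot pass. [difficulty: M] — sources: Titchmarsh1986 §2.12, §3.1, §10.25,
LagariasXiPositivity1999, arXiv:1106.4348, Literature.Barriers.RiemannHypothesis.DavenportHeilbronn,
doi:10.1070/rm2011v066n02abeh004740 -/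
@[route_item "route-RiemannHypothesis-NodalHairpin"]
def NodalLadderEuler : Prop :=
  ∀ δ : ℝ, 0 < δ → ∃ T₀ : ℝ, ∀ s : ℂ, 1 + δ ≤ s.re → T₀ ≤ |s.im| → ((∫ u in (0:ℝ)..1, Literature.NumberTheory.LFunctions.riemannXi (1 / 2 + (u : ℂ) * (s - 1 / 2))) * (s - 1 / 2)).re = 0 → (Literature.NumberTheory.LFunctions.riemannXi s).im ≠ 0

/-- item stmt-RiemannHypothesis-8590 · support · rank 9 · closed · moot by None · by planner
sources: Titchmarsh1986 §2.12, arXiv:1106.4348 Thm 2.1, Literature.NumberTheory.LFunctions.differentiable_riemannXi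
[support] H → 0 at vertical infinity, uniformly in vertical strips: for all σ₁ and ε > 0 there is T
with |H(s)| < ε whenever 1/2 ≤ Re s ≤ σ₁ and |Im s| ≥ T (|H| ≤ ∫_t^∞|ξ(σ+iτ)|dτ and ξ decays like
e^{−π|τ|/4}|τ|^C in the strip; path independence of the primitive). The maximum principle at
infinity used by both cases of NodalDictionary. [difficulty: provable-now] — sources: Titchmarsh1986
§2.12, arXiv:1106.4348 Thm 2.1, Literature.NumberTheory.LFunctions.differentiable_riemannXi -/
@[route_item "route-RiemannHypothesis-NodalHairpin"]
def NodalDecay : Prop :=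
  ∀ σ₁ ε : ℝ, 0 < ε → ∃ T : ℝ, ∀ s : ℂ, 1 / 2 ≤ s.re → s.re ≤ σ₁ → T ≤ |s.im| → |((∫ u in (0:ℝ)..1, Literature.NumberTheory.LFunctions.riemannXi (1 / 2 + (u : ℂ) * (s - 1 / 2))) * (s - 1 / 2)).re| < ε

-- earlier Assembly (stmt-RiemannHypothesis-1023, replaced 2026-08-15T16:17:26Z -> stmt-RiemannHypothesis-10500): retired by None — (∀ s : ℂ, s ∈ {w : ℂ | 1 / 2 < w.re ∧ ((∫ u in (0:ℝ)..1, Literature.NumberTheory.LFunctions.riemannXi (1 / 2 + (u : ℂ) * (w - 1 / 2))) * (w - 1 / 2)).re = 0} → ∃ t : ℝ, ((1 / 2 : ℂ) + t * Complex.I) ∈ closure (connectedComponentIn {w : ℂ | 1 / 2 < w.re ∧ ((∫ u in (0:ℝ)..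
/-- item stmt-RiemannHypothesis-10500 · assembly · rank 1 · closed · moot by None · by planner
sources: Literature.NumberTheory.LFunctions.riemannXi_eq_zero_iff_holds, Literature.NumberTheory.LFunctions.riemannXi_one_sub, Sketch.lean (planner folder) example hD hX
[assembly] restated at rev 5 to the shape of the deciding theorem `closes` (proved in this file): X*
(NodalNoHairpinRegular) and the dictionary over the regular nodal set (NodalDictionaryRegular) give
RH — an off-line zero with Re ρ > 1/2 yields a component of U′ at distance ≥ ε from the line while
X* puts a point of it within ε; Re ρ < 1/2 reflects by riemannXi_one_sub; nontrivial ζ-zeros are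
ξ-zeros (riemannXi_eq_mul_completedRiemannZeta). Closable at once by `closes`. -/
@[route_item "route-RiemannHypothesis-NodalHairpin"]
def Assembly : Prop :=
  NodalNoHairpinRegular → NodalDictionaryRegular → Summit.RiemannHypothesis

end Summit.RiemannHypothesis.RiemannHypothesis.Theses.NodalHairpin
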